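/-
Copyright (c) 2026. All rights reserved.
Released under Apache 2.0 license as described in the file LICENSE.
Authors: abc-iut cell, seat abc-iut-f-069 (gen 4; row «DPSC-NODAL-MODEL»).
-/
import Literature.AnabelianGeometry.AbsoluteAnabelian.AbsTopII.DehnTwistLoopProp13v
import Literature.AnabelianGeometry.AbsoluteAnabelian.AbsTopII.DecompositionGroupsMoreover
import HarnessLib

/-!
# [AbsTopII] Prop 1.3 (v), middle clause (`Prop_1_3_v'`), at the NODAL Dehn-twist datum

S. Mochizuki, *Topics in Absolute Anabelian Geometry II* [AbsTopII] (bib `MochizukiAbsTopII2013`; locators = PDF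
pages of the kurims manuscript `paper:url-585b8d0ad0d9`), §1 Prop 1.3 (v) p. 12, middle clause: "`D_v ∩ Π_I =
C_{Π_I}(I_v) = N_{Π_I}(I_v) = Z_{Π_I}(I_v)` is commensurably terminal in `Π_I`" — abc-iut-L4-t6's typed
`DPSCIndexData.Prop_1_3_v'` (`AbsTopII/InertiaGroups.lean`, FACT-LIST F-0300), stated inside `Π_I` via `subgroupOf`.

PROOF-ONLY (no definition), abc-iut-f-069 (gen 4), row «DPSC-NODAL-MODEL».  At `X = DehnTwist.dpsc i hi` one has
`Π_I = Π_H` (`dpsc_PiI : X.PiI = ⊤`), `I_v = 1 ⋊ Ẑ`, `D_v = Π_v ⋊ Ẑ`; §1 transports normalizers / centralizers /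
commensurators / commensurable terminality along the bijective homomorphism `(⊤ : Subgroup Π_H).subtype`
(generic lemmas for a bijective `f`), §2 computes `Z_{Π_H}(1 ⋊ Ẑ) = N_{Π_H}(1 ⋊ Ẑ) = Fix(twist) ⋊ Ẑ`
(`centralizer_range_inr_eq_normalizer`), §3 concludes:
* `isCommensurablyTerminal_Dv_inf_PiI_subgroupOf_dpsc` — **the commensurable-terminality clause of (v′) HOLDS with no
  hypothesis**;
* `prop_1_3_v'_dpsc_of_fix` — **the typed `Prop_1_3_v'` at `dpsc i hi` MODULO the Dehn-twist fixed-subgroup input `HFix`**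
  (as in `prop13v_dpsc_of_fix`; the normalizer and centralizer clauses need only its `n = 1` case, and by
  `Dv_eq_normalizer_Iv_iff_fix` that case is EXACTLY what they say).
HONEST FRAMING: classical group theory in a constructed model (constructed ≠ geometric); typed ≠ proved for HFix;
nothing here bears on [IUTchIII] Cor 3.12; no side taken.
-/

noncomputable section

open scoped Pointwise

namespace Literature.AnabelianGeometry.AbsoluteAnabelian.AbsTopII.DehnTwist

open Literature.AnabelianGeometry.EtaleTheta.SettingModel
open Literature.AnabelianGeometry.AbsoluteAnabelian
open Function _root_.Topology

/-! ### §1 Transport along a bijective homomorphism -/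

section Transport

variable {A B : Type*} [Group A] [Group B] {f : A →* B}

/-- For a bijective `f`: `H.comap f` and `K.comap f` are commensurable iff `H` and `K` are.
[cite: MochizukiAbsAnab2004, Def 0.1 (iii) p.4] -/
theorem commensurable_comap_iff_of_bijective (hf : Bijective f) (H K : Subgroup B) :
    Subgroup.Commensurable (H.comap f) (K.comap f) ↔ Subgroup.Commensurable H K := by
  constructor
  · intro h
    have h' := commensurable_map_of_injective hf.1 h
    rwa [Subgroup.map_comap_eq_self_of_surjective hf.2, Subgroup.map_comap_eq_self_of_surjective hf.2] at h'
  · exact commensurable_comap f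

/-- For a bijective `f`: `x` commensurates `K.comap f` iff `f x` commensurates `K`.
[cite: MochizukiAbsAnab2004, Def 0.1 (iii) p.4] -/
theorem mem_commensurator_comap_iff_of_bijective (hf : Bijective f) (K : Subgroup B) (x : A) :
    x ∈ Subgroup.Commensurable.commensurator (K.comap f) ↔ f x ∈ Subgroup.Commensurable.commensurator K := by
  rw [Subgroup.Commensurable.commensurator_mem_iff, Subgroup.Commensurable.commensurator_mem_iff,
    ← conj_smul_eq_toConjAct_smul, ← conj_smul_eq_toConjAct_smul, ← comap_conj_smul,
    commensurable_comap_iff_of_bijective hf]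

/-- For a bijective `f`: `x` normalises `K.comap f` iff `f x` normalises `K`. [cite: MochizukiAbsAnab2004, Def 0.1 (iii) p.4] -/
theorem mem_normalizer_comap_iff_of_bijective (hf : Bijective f) (K : Subgroup B) (x : A) :
    x ∈ Subgroup.normalizer ((K.comap f : Subgroup A) : Set A) ↔ f x ∈ Subgroup.normalizer (K : Set B) := by
  rw [← Subgroup.conjAct_pointwise_smul_iff, ← Subgroup.conjAct_pointwise_smul_iff, ← conj_smul_eq_toConjAct_smul,
    ← conj_smul_eq_toConjAct_smul, ← comap_conj_smul]
  exact (Subgroup.comap_injective hf.2).eq_iff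

/-- For a bijective `f`: `x` centralises `K.comap f` iff `f x` centralises `K`. [cite: MochizukiAbsAnab2004, Def 0.1 (iii) p.4] -/
theorem mem_centralizer_comap_iff_of_bijective (hf : Bijective f) (K : Subgroup B) (x : A) :
    x ∈ Subgroup.centralizer ((K.comap f : Subgroup A) : Set A) ↔ f x ∈ Subgroup.centralizer (K : Set B) := by
  rw [Subgroup.mem_centralizer_iff, Subgroup.mem_centralizer_iff]
  constructor
  · intro h k hk
    obtain ⟨y, rfl⟩ := hf.2 k
    have := congrArg f (h y hk)
    rwa [map_mul, map_mul] at this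
  · intro h y hy
    apply hf.1
    rw [map_mul, map_mul]
    exact h (f y) hy

/-- For a bijective `f`: `K.comap f` is commensurably terminal iff... (the direction used) if `K` is.
[cite: MochizukiAbsAnab2004, Def 0.1 (iii) p.4] -/
theorem isCommensurablyTerminal_comap_of_bijective (hf : Bijective f) {K : Subgroup B}
    (hK : IsCommensurablyTerminal K) : IsCommensurablyTerminal (K.comap f) := by
  refine ⟨le_antisymm (fun x hx => ?_) fun x hx => ?_⟩
  · rw [mem_commensurator_comap_iff_of_bijective hf] at hx
    rw [Subgroup.mem_comap, ← hK.commensurator_eq]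
    exact hx
  · rw [mem_commensurator_comap_iff_of_bijective hf, hK.commensurator_eq]
    exact hx

/-- `(⊤ : Subgroup G).subtype` is bijective (used to read the `Π_I`-internal clauses of Prop 1.3 (v) when `Π_I = Π_H`).
[cite: MochizukiAbsTopII2013, Prop 1.3 (v) p.12] -/
theorem bijective_subtype_top {G : Type*} [Group G] : Bijective ((⊤ : Subgroup G).subtype) :=
  ⟨Subgroup.subtype_injective _, fun g => ⟨⟨g, Subgroup.mem_top g⟩, rfl⟩⟩

end Transport

/-! ### §2 The centralizer of the twist section -/

section ExtLevel

variable (i : ℕ)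

/-- **`Z_{Π_H}(1 ⋊ Ẑ) = N_{Π_H}(1 ⋊ Ẑ)`** (`= Fix(twist) ⋊ Ẑ`): `g` centralises the section iff every `shear^i(k)` fixes
`g.left` iff `g` normalises it (`mem_normalizer_range_inr_iff`). [cite: MochizukiAbsTopII2013, Prop 1.3 (v) p.12] -/
theorem centralizer_range_inr_eq_normalizer :
    Subgroup.centralizer (((SemidirectProduct.inr : ZH →* Ext i).range : Subgroup (Ext i)) : Set (Ext i)) =
      Subgroup.normalizer (((SemidirectProduct.inr : ZH →* Ext i).range : Subgroup (Ext i)) : Set (Ext i)) := by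
  ext g
  rw [mem_normalizer_range_inr_iff, Subgroup.mem_centralizer_iff]
  constructor
  · intro h k
    have hk := h (SemidirectProduct.inr k) ⟨k, rfl⟩
    -- `inr k * g = g * inr k` ⇒ `g * inr k * g⁻¹ = inr k`
    have h2 : g * SemidirectProduct.inr k * g⁻¹ = SemidirectProduct.inr k := by
      rw [← hk, mul_inv_cancel_right]
    rw [conj_inr_eq] at h2
    have hl := congrArg SemidirectProduct.left h2
    simp only [SemidirectProduct.mul_left, SemidirectProduct.left_inl, SemidirectProduct.right_inl,
      SemidirectProduct.left_inr, map_one, mul_one] at hl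
    rw [mul_inv_eq_one] at hl
    exact hl.symm
  · rintro h _ ⟨k, rfl⟩
    have h2 : g * SemidirectProduct.inr k * g⁻¹ = SemidirectProduct.inr k := by
      rw [conj_inr_eq, h k, mul_inv_cancel, map_one, one_mul]
    calc SemidirectProduct.inr k * g = g * SemidirectProduct.inr k * g⁻¹ * g := by
          conv_lhs => rw [← h2]
      _ = g * SemidirectProduct.inr k := by rw [inv_mul_cancel_right]

/-- `(Π_v ⋊ Ẑ) ∩ ⊤ = C_⊤(1 ⋊ Ẑ)` read inside the subgroup `⊤ ≤ Π_H`, GIVEN `HFix`. [cite: MochizukiAbsTopII2013, Prop 1.3 (v) p.12] -/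
theorem subgroupOf_top_eq_commensurator_of_fix
    (HFix : ∀ (x : F₂hatT) (n : ℕ), 0 < n → (∀ k : ZH, shearPow i (k ^ n) x = x) → x ∈ vertGp) :
    (vertGp.map (SemidirectProduct.inl : F₂hatT →* Ext i) ⊔ (SemidirectProduct.inr : ZH →* Ext i).range).subgroupOf ⊤ =
      Subgroup.Commensurable.commensurator (((SemidirectProduct.inr : ZH →* Ext i).range).subgroupOf ⊤) := by
  ext x
  change (x : Ext i) ∈ vertGp.map (SemidirectProduct.inl : F₂hatT →* Ext i) ⊔ (SemidirectProduct.inr : ZH →* Ext i).range ↔ x ∈ Subgroup.Commensurable.commensurator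
    (((SemidirectProduct.inr : ZH →* Ext i).range).comap (⊤ : Subgroup (Ext i)).subtype)
  rw [mem_commensurator_comap_iff_of_bijective bijective_subtype_top, commensurator_range_inr_eq_of_fix i HFix]
  rfl

/-- `(Π_v ⋊ Ẑ) ∩ ⊤ = N_⊤(1 ⋊ Ẑ)` inside `⊤ ≤ Π_H`, GIVEN the `n = 1` case of `HFix`. [cite: MochizukiAbsTopII2013, Prop 1.3 (v) p.12] -/
theorem subgroupOf_top_eq_normalizer_of_fix
    (HFix1 : ∀ x : F₂hatT, (∀ k : ZH, shearPow i k x = x) → x ∈ vertGp) :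
    (vertGp.map (SemidirectProduct.inl : F₂hatT →* Ext i) ⊔ (SemidirectProduct.inr : ZH →* Ext i).range).subgroupOf ⊤ =
      Subgroup.normalizer (((((SemidirectProduct.inr : ZH →* Ext i).range).subgroupOf ⊤ :
        Subgroup ↥(⊤ : Subgroup (Ext i))) : Set ↥(⊤ : Subgroup (Ext i)))) := by
  ext x
  change (x : Ext i) ∈ vertGp.map (SemidirectProduct.inl : F₂hatT →* Ext i) ⊔ (SemidirectProduct.inr : ZH →* Ext i).range ↔ x ∈ Subgroup.normalizer
    (((((SemidirectProduct.inr : ZH →* Ext i).range).comap (⊤ : Subgroup (Ext i)).subtype :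
      Subgroup ↥(⊤ : Subgroup (Ext i))) : Set ↥(⊤ : Subgroup (Ext i))))
  rw [mem_normalizer_comap_iff_of_bijective bijective_subtype_top, (normalizer_range_inr_eq_iff_fix i).mpr HFix1]
  rfl

/-- `(Π_v ⋊ Ẑ) ∩ ⊤ = Z_⊤(1 ⋊ Ẑ)` inside `⊤ ≤ Π_H`, GIVEN the `n = 1` case of `HFix`. [cite: MochizukiAbsTopII2013, Prop 1.3 (v) p.12] -/
theorem subgroupOf_top_eq_centralizer_of_fix
    (HFix1 : ∀ x : F₂hatT, (∀ k : ZH, shearPow i k x = x) → x ∈ vertGp) :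
    (vertGp.map (SemidirectProduct.inl : F₂hatT →* Ext i) ⊔ (SemidirectProduct.inr : ZH →* Ext i).range).subgroupOf ⊤ =
      Subgroup.centralizer (((((SemidirectProduct.inr : ZH →* Ext i).range).subgroupOf ⊤ :
        Subgroup ↥(⊤ : Subgroup (Ext i))) : Set ↥(⊤ : Subgroup (Ext i)))) := by
  ext x
  change (x : Ext i) ∈ vertGp.map (SemidirectProduct.inl : F₂hatT →* Ext i) ⊔ (SemidirectProduct.inr : ZH →* Ext i).range ↔ x ∈ Subgroup.centralizer
    (((((SemidirectProduct.inr : ZH →* Ext i).range).comap (⊤ : Subgroup (Ext i)).subtype :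
      Subgroup ↥(⊤ : Subgroup (Ext i))) : Set ↥(⊤ : Subgroup (Ext i))))
  rw [mem_centralizer_comap_iff_of_bijective bijective_subtype_top, centralizer_range_inr_eq_normalizer,
    (normalizer_range_inr_eq_iff_fix i).mpr HFix1]
  rfl

/-- `(Π_v ⋊ Ẑ) ∩ ⊤` is commensurably terminal in `⊤ ≤ Π_H` — no hypothesis. [cite: MochizukiAbsTopII2013, Prop 1.3 (v) p.12] -/
theorem isCommensurablyTerminal_normalizer_map_inl_vertGp_subgroupOf_top :
    IsCommensurablyTerminal ((Subgroup.normalizer ((vertGp.map (SemidirectProduct.inl : F₂hatT →* Ext i) :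
      Subgroup (Ext i)) : Set (Ext i))).subgroupOf ⊤) :=
  isCommensurablyTerminal_comap_of_bijective bijective_subtype_top (isCommensurablyTerminal_normalizer_map_inl_vertGp i)

end ExtLevel

/-! ### §3 `Prop_1_3_v'` at `dpsc i hi` -/

section Dpsc

variable {i : ℕ} (hi : 0 < i)

/-- **The commensurable-terminality clause of (v′) — `D_v ∩ Π_I` commensurably terminal in `Π_I` — HOLDS at the nodal
datum with no hypothesis** (`Π_I = Π_H`; transport of `isCommensurablyTerminal_Dv_dpsc`).
[cite: MochizukiAbsTopII2013, Prop 1.3 (v) p.12] -/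
theorem isCommensurablyTerminal_Dv_inf_PiI_subgroupOf_dpsc (v : (dpsc i hi).Vert) :
    IsCommensurablyTerminal (((dpsc i hi).Dv v ⊓ (dpsc i hi).PiI).subgroupOf (dpsc i hi).PiI) := by
  rw [dpsc_PiI, inf_top_eq]
  exact isCommensurablyTerminal_normalizer_map_inl_vertGp_subgroupOf_top i

/-- **[AbsTopII] Prop 1.3 (v) middle clause — the typed `Prop_1_3_v'` (F-0300) — at the nodal Dehn-twist datum MODULO
the Dehn-twist fixed-subgroup input `HFix`** (commensurator clause: all `n`; normalizer and centralizer clauses: the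
case `n = 1`; the commensurable-terminality clause is unconditional). [cite: MochizukiAbsTopII2013, Prop 1.3 (v) p.12] -/
theorem prop_1_3_v'_dpsc_of_fix
    (HFix : ∀ (x : F₂hatT) (n : ℕ), 0 < n → (∀ k : ZH, shearPow i (k ^ n) x = x) → x ∈ vertGp) :
    Literature.AnabelianGeometry.AbsoluteAnabelian.AbsTopII.DPSCIndexData.Prop_1_3_v' (dpsc i hi) := by
  have HFix1 : ∀ x : F₂hatT, (∀ k : ZH, shearPow i k x = x) → x ∈ vertGp :=
    fun x hx => HFix x 1 Nat.one_pos (fun k => by rw [pow_one]; exact hx k)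
  have hD : ∀ v : (dpsc i hi).Vert, (dpsc i hi).Dv v =
      vertGp.map (SemidirectProduct.inl : F₂hatT →* Ext i) ⊔ (SemidirectProduct.inr : ZH →* Ext i).range :=
    fun v => normalizer_map_inl_vertGp_eq i
  intro v
  refine ⟨?_, ?_, ?_, isCommensurablyTerminal_Dv_inf_PiI_subgroupOf_dpsc hi v⟩
  · rw [dpsc_PiI, inf_top_eq, Iv_dpsc_eq_range_inr_holds hi, hD]
    exact subgroupOf_top_eq_commensurator_of_fix i HFix
  · rw [dpsc_PiI, inf_top_eq, Iv_dpsc_eq_range_inr_holds hi, hD]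
    exact subgroupOf_top_eq_normalizer_of_fix i HFix1
  · rw [dpsc_PiI, inf_top_eq, Iv_dpsc_eq_range_inr_holds hi, hD]
    exact subgroupOf_top_eq_centralizer_of_fix i HFix1

end Dpsc

/-! ### Appended: [AbsTopII] Prop 1.3 (iv) «Moreover» at the nodal datum — VACUOUS (one vertex) -/

section Moreover

variable {i : ℕ} (hi : 0 < i)

/-- **The typed «Moreover» clauses of Prop 1.3 (iv) (`DPSCData.Prop13iv_moreover`, abc-iut-L4-t6 p431316) HOLD at the
nodal Dehn-twist datum — VACUOUSLY**: both clauses quantify over DISTINCT vertices `v ≠ v'`, and `dpsc i hi` has one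
vertex (`dpsc_vert_eq`).  Census entry only; a non-idle instance needs a two-vertex nodal model (open).
[cite: MochizukiAbsTopII2013, Prop 1.3 (iv) p.12] -/
theorem prop13iv_moreover_dpsc_holds :
    Literature.AnabelianGeometry.AbsoluteAnabelian.DPSCData.Prop13iv_moreover (dpsc i hi).toDPSCData :=
  ⟨fun v v' _ hne _ _ => absurd (dpsc_vert_eq hi v v') hne, fun v v' _ hne _ _ _ _ _ => absurd (dpsc_vert_eq hi v v') hne⟩

end Moreover

end Literature.AnabelianGeometry.AbsoluteAnabelian.AbsTopII.DehnTwist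

end
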